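import Literature.NumberTheory.DiophantineGeometry.PlaneCurvePointCountProofs
import Literature.NumberTheory.DiophantineGeometry.PlaneCurveWeightedProofs
import Literature.FieldTheory.ArtinSchreier.PrimeDegree
import HarnessLib

/-!
# Rational points on the Artin–Schreier curves `zᵖ - z = P(x)/Q(x)` over a finite field

Library file of the function-field chain (`PlaneCurve*`, `FunctionField*`). For a finite field `K`
of characteristic `p` and polynomials `P, Q ∈ K[X]` we consider the plane model

  `Φ = Yᵖ - Q(X)ᵖ⁻¹ Y - P(X) Q(X)ᵖ⁻¹ ∈ K[X][Y]`   (`asPlaneModel p P Q`)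

of the Artin–Schreier curve `zᵖ - z = P(x)/Q(x)` (`Y = Q(X) z`). It is monic of degree `p` in
`Y` and *weighted* of weight `k = max (deg P, deg Q)` in the sense of `PlaneCurveWeightedProofs`.
When `P/Q` has a pole of order prime to `p` (here: `P, Q` coprime and `1 ≤ deg Q < p`), the
Artin–Schreier polynomial `Yᵖ - Y - P/Q` has no root in `K(X)` and is therefore irreducible over
`K(X)` (Lang, *Algebra* VI Thm. 6.4, `Literature.FieldTheory.ArtinSchreier`), so the function field
`F = K(X)[Y]/(Φ)` is defined, separable of degree `p` over `K(X)`; a zero `c₀ ∈ K` of `P` with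
`Q(c₀) ≠ 0` provides a rational place, so `K` is the full constant field. The main result
`abs_card_zeros_asPlaneModel_sub_le` is **Weil's bound for the number of rational points**

  `|#{(a, b) ∈ K² : Φ(a, b) = 0} - (#K + 1)| ≤ (p - 1)(k p - 2) √#K + p (k + 1)`,

obtained exactly as `abs_card_zeros_sub_le` (`PlaneCurvePointCountProofs`): Hasse–Weil for `F`
(`hasseWeil_holds` through `card_toFinset_degree_eq_one_mem_Icc`), the weighted genus bound
`2g ≤ (p-1)(kp-2)` (`two_mul_genus_le_of_planeModel_weighted`), and the fibrewise comparison of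
rational points and rational places through Kummer's theorem (`card_filter_valuation_sub_lt_one_eq`)
— the fibre `Φ(a, Y) = Yᵖ - Q(a)ᵖ⁻¹ Y - P(a)Q(a)ᵖ⁻¹` being separable for `Q(a) ≠ 0`.

This is the geometric input of Weil's bound `|∑_{x ∈ 𝔽_p, Q(x) ≠ 0} ψ(P(x)/Q(x))| ≤ C √p` for
exponential sums with a rational argument (Weil 1948; Schmidt 1976, Ch. II), used for
Heath-Brown's Theorem 2 (Acta Arith. 2001, §9).

## References

* A. Weil, *On some exponential sums*, Proc. Nat. Acad. Sci. USA 34 (1948) 204–207. [Weil1948]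
* W. M. Schmidt, *Equations over Finite Fields. An Elementary Approach*, LNM 536, Springer 1976,
  Ch. II (exponential sums), Ch. III (Artin–Schreier function fields). [Schmidt1976]
* H. Stichtenoth, *Algebraic Function Fields and Codes*, 2nd ed., GTM 254, Springer 2009,
  Prop. 3.7.8, Thm. 3.3.7, Thm. 5.2.3. [Stichtenoth2009]
* S. Lang, *Algebra*, GTM 211, Ch. VI §6, Thm. 6.4. [Lang2002]
-/

noncomputable section

open scoped Classical Polynomial.Bivariate IntermediateField
open Polynomial

namespace Literature.NumberTheory.DiophantineGeometry.AlgFunctionField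

universe u

variable {K : Type u} [Field K]

/-! ### The plane model `Yᵖ - Qᵖ⁻¹ Y - P Qᵖ⁻¹` -/

/-- The plane model `Φ = Yᵖ - Q(X)ᵖ⁻¹ Y - P(X) Q(X)ᵖ⁻¹ ∈ K[X][Y]` of the Artin–Schreier curve
`zᵖ - z = P(x)/Q(x)` (substitute `Y = Q(X) z` and multiply by `Qᵖ`). [cite: Schmidt1976, Ch. III] -/
def asPlaneModel (p : ℕ) (P Q : K[X]) : K[X][Y] :=
  X ^ p - C (Q ^ (p - 1)) * X - C (P * Q ^ (p - 1))

section Basic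

variable {p : ℕ} (hp : 2 ≤ p) (P Q : K[X])
include hp

omit hp in
/-- `Φ = Yᵖ - (Qᵖ⁻¹ Y + P Qᵖ⁻¹)`. [folklore] -/
theorem asPlaneModel_eq : asPlaneModel p P Q =
    X ^ p - (C (Q ^ (p - 1)) * X + C (P * Q ^ (p - 1))) := by
  rw [asPlaneModel, sub_sub]

omit hp in
/-- The lower-order part `Qᵖ⁻¹ Y + P Qᵖ⁻¹` has degree `≤ 1` in `Y`. [folklore] -/
theorem natDegree_tail_le :
    (C (Q ^ (p - 1)) * X + C (P * Q ^ (p - 1)) : K[X][Y]).natDegree ≤ 1 :=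
  (natDegree_add_le _ _).trans
    (max_le ((natDegree_C_mul_le _ _).trans natDegree_X_le) (by rw [natDegree_C]; exact Nat.zero_le _))

/-- The lower-order part has degree `< p`. [folklore] -/
theorem degree_tail_lt : (C (Q ^ (p - 1)) * X + C (P * Q ^ (p - 1)) : K[X][Y]).degree < p := by
  rcases eq_or_ne (C (Q ^ (p - 1)) * X + C (P * Q ^ (p - 1)) : K[X][Y]) 0 with h0 | h0
  · rw [h0, degree_zero]; exact WithBot.bot_lt_coe p
  · rw [degree_eq_natDegree h0]
    exact_mod_cast (natDegree_tail_le P Q).trans_lt (by omega)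

/-- `Φ` is monic in `Y`. [folklore] -/
theorem monic_asPlaneModel : (asPlaneModel p P Q).Monic := by
  rw [asPlaneModel_eq]
  exact monic_X_pow_sub (degree_tail_lt hp P Q)

/-- `deg_Y Φ = p`. [folklore] -/
theorem natDegree_asPlaneModel : (asPlaneModel p P Q).natDegree = p := by
  have h : (C (Q ^ (p - 1)) * X + C (P * Q ^ (p - 1)) : K[X][Y]).natDegree <
      ((X : K[X][Y]) ^ p).natDegree := by
    rw [natDegree_X_pow]
    exact (natDegree_tail_le P Q).trans_lt (by omega)
  rw [asPlaneModel_eq, natDegree_sub_eq_left_of_natDegree_lt h, natDegree_X_pow]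

omit hp in
/-- The coefficients of `Φ` below the top one. [folklore] -/
theorem coeff_asPlaneModel (i : ℕ) : (asPlaneModel p P Q).coeff i =
    (if i = p then 1 else 0) - (if i = 1 then Q ^ (p - 1) else 0) -
      (if i = 0 then P * Q ^ (p - 1) else 0) := by
  rw [asPlaneModel, coeff_sub, coeff_sub, coeff_X_pow, coeff_C_mul_X, coeff_C]

/-- **`Φ` is weighted of weight `k`** whenever `deg P ≤ k` and `deg Q ≤ k`:
`deg_X (coeff of Yⁱ) ≤ k (p - i)` for `i < p`. [folklore] -/
theorem natDegree_coeff_asPlaneModel_le {k : ℕ} (hP : P.natDegree ≤ k) (hQ : Q.natDegree ≤ k)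
    (i : ℕ) (hi : i < (asPlaneModel p P Q).natDegree) :
    ((asPlaneModel p P Q).coeff i).natDegree ≤ k * ((asPlaneModel p P Q).natDegree - i) := by
  rw [natDegree_asPlaneModel hp] at hi ⊢
  rw [coeff_asPlaneModel, if_neg hi.ne]
  have hQpow : (Q ^ (p - 1)).natDegree ≤ k * (p - 1) :=
    natDegree_pow_le_of_le (p - 1) hQ |>.trans_eq (mul_comm _ _)
  rcases eq_or_ne i 0 with rfl | hi0
  · rw [if_neg (show (0 : ℕ) ≠ 1 from zero_ne_one), if_pos rfl, sub_zero, zero_sub, natDegree_neg,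
      Nat.sub_zero]
    refine (natDegree_mul_le).trans ?_
    have : k + k * (p - 1) = k * p := by
      rcases p with _ | p
      · omega
      · rw [Nat.add_sub_cancel]; ring
    calc P.natDegree + (Q ^ (p - 1)).natDegree ≤ k + k * (p - 1) := add_le_add hP hQpow
      _ = k * p := this
  rcases eq_or_ne i 1 with rfl | hi1
  · rw [if_pos rfl, if_neg one_ne_zero, zero_sub, sub_zero, natDegree_neg]
    exact hQpow
  · rw [if_neg hi1, if_neg hi0, sub_zero, sub_zero, natDegree_zero]
    exact Nat.zero_le _

omit hp in
/-- `Φ(a, b) = bᵖ - Q(a)ᵖ⁻¹ b - P(a) Q(a)ᵖ⁻¹`. [folklore] -/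
theorem evalEval_asPlaneModel (a b : K) : (asPlaneModel p P Q).evalEval a b =
    b ^ p - Q.eval a ^ (p - 1) * b - P.eval a * Q.eval a ^ (p - 1) := by
  simp only [asPlaneModel, evalEval, eval_sub, eval_pow, eval_mul, eval_X, eval_C]

omit hp in
/-- The fibre polynomial `Φ(a, Y) = Yᵖ - Q(a)ᵖ⁻¹ Y - P(a)Q(a)ᵖ⁻¹`. [folklore] -/
theorem map_evalRingHom_asPlaneModel (a : K) : (asPlaneModel p P Q).map (evalRingHom a) =
    X ^ p - C (Q.eval a ^ (p - 1)) * X - C (P.eval a * Q.eval a ^ (p - 1)) := by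
  simp only [asPlaneModel, Polynomial.map_sub, Polynomial.map_pow, map_X, Polynomial.map_mul,
    map_C, coe_evalRingHom, eval_pow, eval_mul]

omit hp in
/-- A polynomial whose derivative is a non-zero constant is separable. [folklore] -/
theorem separable_of_derivative_eq_C {R : Type*} [Field R] {f : R[X]} {c : R} (hc : c ≠ 0)
    (hf : derivative f = C c) : f.Separable := by
  rw [separable_def, hf]
  exact ⟨0, C c⁻¹, by rw [zero_mul, zero_add, ← C_mul, inv_mul_cancel₀ hc, C_1]⟩

omit hp in
/-- In characteristic `p` the derivative of `Yᵖ - C u Y - C v` is the constant `-u`. [folklore] -/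
theorem derivative_X_pow_sub {R : Type*} [CommRing R] [CharP R p] (u v : R) :
    derivative (X ^ p - C u * X - C v : R[X]) = C (-u) := by
  rw [derivative_sub, derivative_sub, derivative_X_pow, derivative_C_mul_X, derivative_C,
    CharP.cast_eq_zero R p, C_0, zero_mul, zero_sub, sub_zero, C_neg]

variable [CharP K p]

omit hp in
/-- **The fibre `Φ(a, Y)` is separable when `Q(a) ≠ 0`** (its derivative is `-Q(a)ᵖ⁻¹`).
[folklore] -/
theorem separable_fibre_asPlaneModel {a : K} (ha : Q.eval a ≠ 0) :
    ((asPlaneModel p P Q).map (evalRingHom a)).Separable := by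
  rw [map_evalRingHom_asPlaneModel]
  exact separable_of_derivative_eq_C (neg_ne_zero.2 (pow_ne_zero _ ha))
    (derivative_X_pow_sub _ _)

omit hp in
/-- **`Φ` is separable over `K(X)`** when `Q ≠ 0` (derivative `-Qᵖ⁻¹`). [folklore] -/
theorem separable_map_asPlaneModel (hQ0 : Q ≠ 0) :
    ((asPlaneModel p P Q).map (algebraMap K[X] (RatFunc K))).Separable := by
  have h : (asPlaneModel p P Q).map (algebraMap K[X] (RatFunc K)) =
      X ^ p - C (algebraMap K[X] (RatFunc K) Q ^ (p - 1)) * X -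
        C (algebraMap K[X] (RatFunc K) P * algebraMap K[X] (RatFunc K) Q ^ (p - 1)) := by
    simp only [asPlaneModel, Polynomial.map_sub, Polynomial.map_pow, map_X, Polynomial.map_mul,
      map_C, map_pow, map_mul]
  rw [h]
  refine separable_of_derivative_eq_C (neg_ne_zero.2 (pow_ne_zero _ ?_))
    (derivative_X_pow_sub _ _)
  exact (map_ne_zero_iff _ (IsFractionRing.injective K[X] (RatFunc K))).2 hQ0

end Basic

/-! ### No Artin–Schreier root: `sᵖ - s ≠ P/Q` when `P/Q` has a pole of order prime to `p` -/

section NoRoot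

/-- Powers of a prime separate: `πᵐ A = πᵏ B` with `π ∤ A`, `π ∤ B` forces `m = k`. [folklore] -/
theorem pow_mul_eq_pow_mul_cancel {R : Type*} [CommRing R] [IsDomain R] {π A B : R} (hπ : Prime π)
    (hA : ¬ π ∣ A) (hB : ¬ π ∣ B) {m k : ℕ} (h : π ^ m * A = π ^ k * B) : m = k := by
  by_contra hne
  wlog hlt : m < k generalizing m k A B
  · exact this hB hA h.symm (Ne.symm hne) (lt_of_le_of_ne (not_lt.1 hlt) (Ne.symm hne))
  have hsplit : π ^ k = π ^ m * π ^ (k - m) := by rw [← pow_add]; congr 1; omega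
  rw [hsplit, mul_assoc] at h
  have h' : A = π ^ (k - m) * B := mul_left_cancel₀ (pow_ne_zero _ hπ.ne_zero) h
  exact hA (h' ▸ dvd_mul_of_dvd_left (dvd_pow_self π (by omega)) B)

/-- **Clearing denominators.** If `s = a/b ∈ K(X)` satisfies `sⁿ⁺¹ - s = P/Q` then
`Q (aⁿ⁺¹ - a bⁿ) = P bⁿ⁺¹` in `K[X]`. [folklore] -/
theorem num_denom_eq_of_pow_sub_eq_div {P Q : K[X]} (hQ0 : Q ≠ 0) {n : ℕ} {s : RatFunc K}
    (hs : s ^ (n + 1) - s = algebraMap K[X] (RatFunc K) P / algebraMap K[X] (RatFunc K) Q) :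
    Q * (s.num ^ (n + 1) - s.num * s.denom ^ n) = P * s.denom ^ (n + 1) := by
  have hinj : Function.Injective (algebraMap K[X] (RatFunc K)) :=
    IsFractionRing.injective K[X] (RatFunc K)
  have hbL : algebraMap K[X] (RatFunc K) s.denom ≠ 0 :=
    (map_ne_zero_iff _ hinj).2 (RatFunc.denom_ne_zero s)
  have hQL : algebraMap K[X] (RatFunc K) Q ≠ 0 := (map_ne_zero_iff _ hinj).2 hQ0
  have ha : algebraMap K[X] (RatFunc K) s.num = s * algebraMap K[X] (RatFunc K) s.denom :=
    (div_eq_iff hbL).1 (RatFunc.num_div_denom s)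
  apply hinj
  simp only [map_mul, map_sub, map_pow]
  rw [ha]
  calc algebraMap K[X] (RatFunc K) Q * ((s * algebraMap K[X] (RatFunc K) s.denom) ^ (n + 1) -
        s * algebraMap K[X] (RatFunc K) s.denom * algebraMap K[X] (RatFunc K) s.denom ^ n)
        = algebraMap K[X] (RatFunc K) Q * (s ^ (n + 1) - s) *
            algebraMap K[X] (RatFunc K) s.denom ^ (n + 1) := by ring
    _ = algebraMap K[X] (RatFunc K) P * algebraMap K[X] (RatFunc K) s.denom ^ (n + 1) := by
          rw [hs, mul_div_cancel₀ _ hQL]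

/-- **`Yᵖ - Y - P/Q` has no root in `K(X)`** when `P, Q` are coprime and `1 ≤ deg Q < p`: at an
irreducible factor `π` of `Q`, of multiplicity `m` with `1 ≤ m ≤ deg Q < p`, a root `s = a/b`
would give `Q(aᵖ - a bᵖ⁻¹) = P bᵖ`, whose `π`-adic orders are `m` on the left and `p · ord_π b` on
the right. (Any field `K`; `p` need not be prime.) [cite: Schmidt1976, Ch. III] -/
theorem pow_sub_self_ne_div {P Q : K[X]} (hPQ : IsCoprime P Q) (hQ1 : 1 ≤ Q.natDegree) {p : ℕ}
    (hQp : Q.natDegree < p) (s : RatFunc K) :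
    s ^ p - s ≠ algebraMap K[X] (RatFunc K) P / algebraMap K[X] (RatFunc K) Q := by
  intro hs
  obtain ⟨n, rfl⟩ : ∃ n, p = n + 1 := ⟨p - 1, by omega⟩
  have hQ0 : Q ≠ 0 := by rintro rfl; simp at hQ1
  have key := num_denom_eq_of_pow_sub_eq_div hQ0 hs
  set a := s.num with ha
  set b := s.denom with hb
  have hb0 : b ≠ 0 := RatFunc.denom_ne_zero s
  have hab : IsCoprime a b := RatFunc.isCoprime_num_denom s
  -- an irreducible factor `π` of `Q`, `Q = π^m Q'`, `b = π^e b'`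
  have hQu : ¬ IsUnit Q := fun h ↦ by
    have := natDegree_eq_zero_of_isUnit h
    omega
  obtain ⟨π, hπirr, hπQ⟩ := WfDvdMonoid.exists_irreducible_factor hQu hQ0
  have hπ : Prime π := hπirr.prime
  obtain ⟨m, Q', hπQ', hQeq⟩ := WfDvdMonoid.max_power_factor hQ0 hπirr
  obtain ⟨e, b', hπb', hbeq⟩ := WfDvdMonoid.max_power_factor hb0 hπirr
  have hπP : ¬ π ∣ P := fun h ↦ hπirr.not_isUnit (hPQ.isUnit_of_dvd' h hπQ)
  -- `π ∣ b` (from `π ∣ Q ∣ P b^p`), hence `π ∤ a` and `π ∤ a^p - a b^(p-1)`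
  have hπb : π ∣ b := by
    have h1 : π ∣ P * b ^ (n + 1) := by rw [← key]; exact dvd_mul_of_dvd_left hπQ _
    rcases hπ.dvd_or_dvd h1 with h2 | h2
    · exact absurd h2 hπP
    · exact hπ.dvd_of_dvd_pow h2
  have hπa : ¬ π ∣ a := fun h ↦ hπirr.not_isUnit (hab.isUnit_of_dvd' h hπb)
  have hn : n ≠ 0 := by omega
  have hπA : ¬ π ∣ a ^ (n + 1) - a * b ^ n := by
    intro h
    have h2 : π ∣ a * b ^ n := dvd_mul_of_dvd_right (dvd_pow hπb hn) a
    have h3 : π ∣ a ^ (n + 1) := by simpa using dvd_add h h2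
    exact hπa (hπ.dvd_of_dvd_pow h3)
  -- compare `π`-adic orders in `π^m Q' (a^p - a b^(p-1)) = π^(e p) (P b'^p)`
  have hEq : π ^ m * (Q' * (a ^ (n + 1) - a * b ^ n)) = π ^ (e * (n + 1)) * (P * b' ^ (n + 1)) := by
    rw [← mul_assoc, ← hQeq, key, hbeq, mul_pow, ← pow_mul]; ring
  have hA : ¬ π ∣ Q' * (a ^ (n + 1) - a * b ^ n) := fun h ↦
    (hπ.dvd_or_dvd h).elim hπQ' hπA
  have hB : ¬ π ∣ P * b' ^ (n + 1) := fun h ↦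
    (hπ.dvd_or_dvd h).elim hπP fun h' ↦ hπb' (hπ.dvd_of_dvd_pow h')
  have hme : m = e * (n + 1) := pow_mul_eq_pow_mul_cancel hπ hA hB hEq
  -- `1 ≤ m ≤ deg Q < p = n + 1` but `p ∣ m`
  have hm1 : m ≠ 0 := by
    rintro rfl
    rw [pow_zero, one_mul] at hQeq
    exact hπQ' (hQeq ▸ hπQ)
  have hQ'0 : Q' ≠ 0 := by rintro rfl; rw [mul_zero] at hQeq; exact hQ0 hQeq
  have hπdeg : 1 ≤ π.natDegree := by
    have := degree_pos_of_irreducible hπirr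
    rw [degree_eq_natDegree hπ.ne_zero] at this
    exact_mod_cast this
  have hmle : m ≤ Q.natDegree := by
    rw [hQeq, natDegree_mul (pow_ne_zero _ hπ.ne_zero) hQ'0, natDegree_pow]
    nlinarith
  have he : 1 ≤ e := by
    rcases Nat.eq_zero_or_pos e with rfl | he
    · rw [zero_mul] at hme; exact absurd hme hm1
    · exact he
  have : n + 1 ≤ m := by rw [hme]; nlinarith
  omega

end NoRoot

/-! ### The function field `K(X)[Y]/(Φ)`: irreducibility and separability -/

section FunctionField

variable {p : ℕ} [Fact p.Prime] [CharP K p]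

/-- **`Φ` is irreducible over `K(X)`** when `P, Q` are coprime and `1 ≤ deg Q < p`: up to the unit
`Qᵖ` and the substitution `Y ↦ Q Y` it is the Artin–Schreier polynomial `Yᵖ - Y - P/Q`, which has
no root in `K(X)` (`pow_sub_self_ne_div`) and is therefore irreducible (Lang VI Thm. 6.4).
[cite: Lang2002, Ch. VI §6 Thm. 6.4] -/
theorem irreducible_map_asPlaneModel {P Q : K[X]} (hPQ : IsCoprime P Q) (hQ1 : 1 ≤ Q.natDegree)
    (hQp : Q.natDegree < p) :
    Irreducible ((asPlaneModel p P Q).map (algebraMap K[X] (RatFunc K))) := by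
  have hp : p.Prime := Fact.out
  have hp0 : p ≠ 0 := hp.ne_zero
  have hQ0 : Q ≠ 0 := by rintro rfl; simp at hQ1
  have hQt0 : algebraMap K[X] (RatFunc K) Q ≠ 0 :=
    (map_ne_zero_iff _ (IsFractionRing.injective K[X] (RatFunc K))).2 hQ0
  -- the Artin–Schreier polynomial and its irreducibility
  have hAS : Irreducible (X ^ p - X -
      C (algebraMap K[X] (RatFunc K) P / algebraMap K[X] (RatFunc K) Q) : (RatFunc K)[X]) :=
    Literature.FieldTheory.ArtinSchreier.X_pow_sub_X_sub_C_irreducible p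
      (pow_sub_self_ne_div hPQ hQ1 hQp)
  have hunit : IsUnit (C (algebraMap K[X] (RatFunc K) Q ^ p) : (RatFunc K)[X]) :=
    isUnit_C.2 (IsUnit.mk0 _ (pow_ne_zero _ hQt0))
  have h1 := (irreducible_isUnit_mul hunit).2 hAS
  -- `Φ(Q Y) = Qᵖ · (Yᵖ - Y - P/Q)`
  letI : Invertible (algebraMap K[X] (RatFunc K) Q) := invertibleOfNonzero hQt0
  have hmap : (asPlaneModel p P Q).map (algebraMap K[X] (RatFunc K)) =
      X ^ p - C (algebraMap K[X] (RatFunc K) Q ^ (p - 1)) * X -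
        C (algebraMap K[X] (RatFunc K) P * algebraMap K[X] (RatFunc K) Q ^ (p - 1)) := by
    simp only [asPlaneModel, Polynomial.map_sub, Polynomial.map_pow, map_X, Polynomial.map_mul,
      map_C, map_pow, map_mul]
  have hQp1 : algebraMap K[X] (RatFunc K) Q ^ p =
      algebraMap K[X] (RatFunc K) Q ^ (p - 1) * algebraMap K[X] (RatFunc K) Q :=
    (pow_sub_one_mul hp0 _).symm
  have hcomp : algEquivCMulXAddC (algebraMap K[X] (RatFunc K) Q) (0 : RatFunc K)
      ((asPlaneModel p P Q).map (algebraMap K[X] (RatFunc K))) =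
      C (algebraMap K[X] (RatFunc K) Q ^ p) * (X ^ p - X -
        C (algebraMap K[X] (RatFunc K) P / algebraMap K[X] (RatFunc K) Q)) := by
    rw [algEquivCMulXAddC_apply, ← comp_eq_aeval, hmap]
    simp only [sub_comp, pow_comp, mul_comp, X_comp, C_comp, map_zero, add_zero]
    have hc : C (algebraMap K[X] (RatFunc K) Q ^ p) *
        C (algebraMap K[X] (RatFunc K) P / algebraMap K[X] (RatFunc K) Q) =
        (C (algebraMap K[X] (RatFunc K) P * algebraMap K[X] (RatFunc K) Q ^ (p - 1)) :
          (RatFunc K)[X]) := by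
      rw [← C_mul, hQp1, mul_assoc, mul_div_cancel₀ _ hQt0, mul_comm]
    rw [mul_sub, mul_sub, hc, mul_pow, ← C_pow]
    congr 1
    rw [hQp1, C_mul]
    ring
  have h2 : Irreducible (algEquivCMulXAddC (algebraMap K[X] (RatFunc K) Q) (0 : RatFunc K)
      ((asPlaneModel p P Q).map (algebraMap K[X] (RatFunc K)))) := by
    rw [hcomp]; exact h1
  exact (MulEquiv.irreducible_iff
    (algEquivCMulXAddC (algebraMap K[X] (RatFunc K) Q) (0 : RatFunc K))).1 h2

end FunctionField

/-! ### Rational points versus rational places, with a prescribed set of bad fibres -/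

section Model

variable {F : Type u} [Field F] [Algebra K F] [Algebra K[X] F] [Algebra (RatFunc K) F]
  [IsScalarTower K[X] (RatFunc K) F] [IsScalarTower K (RatFunc K) F] [IsScalarTower K K[X] F]
variable [Fintype K] [IsAlgFunctionField K F] [FiniteDimensional (RatFunc K) F]
  [Algebra.IsSeparable (RatFunc K) F]

/-- **Rational points versus rational places of a plane model, given the bad fibres.** Let `F/K(x)`
be finite separable, generated by `y` with minimal polynomial `Φ ∈ K[X][Y]` (monic of degree `d`
in `Y`), `K` finite, and let `bad ⊆ K` contain every `a` whose fibre polynomial `Φ(a, Y)` is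
inseparable. Then the number `N` of rational points of `Φ = 0` and the number `N₁` of rational
places of `F/K` satisfy `N ≤ N₁ + d · #bad` and `N₁ ≤ N + d + d · #bad` (poles of `x`: at most `d`;
good fibres: Kummer, `card_filter_valuation_sub_lt_one_eq`; bad fibres: at most `d` on either side).
This is `card_zeros_le_card_ratPlaces_add` with the bad set as a parameter. [folklore] -/
theorem card_zeros_le_card_ratPlaces_add_of_bad {Φ : K[X][Y]} (hm : Φ.Monic) {y : F}
    (hmin : minpoly (RatFunc K) y = Φ.map (algebraMap K[X] (RatFunc K)))
    (hfin : Module.finrank (RatFunc K) F = Φ.natDegree) (bad : Finset K)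
    (hsep : ∀ a, a ∉ bad → (Φ.map (evalRingHom a)).Separable) :
    (Finset.univ.filter fun p : K × K ↦ Φ.evalEval p.1 p.2 = 0).card ≤
        (finite_setOf_degree_eq (K := K) (F := F) 1).toFinset.card + Φ.natDegree * bad.card ∧
      (finite_setOf_degree_eq (K := K) (F := F) 1).toFinset.card ≤
        (Finset.univ.filter fun p : K × K ↦ Φ.evalEval p.1 p.2 = 0).card + Φ.natDegree +
          Φ.natDegree * bad.card := by
  set x : F := algebraMap K[X] F X with hx
  have hxt : Transcendental K x := transcendental_algebraMap_X K F
  have hfinx : Module.finrank K⟮x⟯ F = Φ.natDegree := by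
    rw [hx, finrank_adjoin_algebraMap_X K F, hfin]
  set d := Φ.natDegree with hd
  set S := (finite_setOf_degree_eq (K := K) (F := F) 1).toFinset with hS
  set np := (S.filter fun P ↦ x ∉ P.toValuationSubring).card with hnp
  set r : K → ℕ := fun a ↦ (S.filter fun P ↦ P.valuation (x - algebraMap K F a) < 1).card with hr
  set t : K → ℕ := fun a ↦ ((Finset.univ : Finset K).filter fun b ↦ Φ.evalEval a b = 0).card
    with ht
  set N := ((Finset.univ : Finset (K × K)).filter fun pt ↦ Φ.evalEval pt.1 pt.2 = 0).card with hN
  have hNsum : N = ∑ a, t a := card_filter_evalEval_eq_sum Φ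
  have hN₁sum : S.card = np + ∑ a, r a := card_ratPlaces_eq_card_poles_add_sum x
  have hple : np ≤ d := by
    have := card_filter_not_mem_le (K := K) (F := F) hxt
    rwa [hfinx] at this
  have hrle : ∀ a, r a ≤ d := fun a ↦ by
    have := card_filter_valuation_sub_lt_one_le (K := K) (F := F) hxt a
    rwa [hfinx] at this
  have htle : ∀ a, t a ≤ d := fun a ↦ card_filter_evalEval_le hm a
  have hgood : ∀ a, a ∉ bad → r a = t a := fun a ha ↦
    card_filter_valuation_sub_lt_one_eq (K := K) (F := F) hm hmin hfin a (hsep a ha)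
  have hsumt : ∑ a, t a = ∑ a ∈ Finset.univ.filter (fun a ↦ a ∉ bad), t a + ∑ a ∈ bad, t a := by
    rw [← Finset.sum_filter_add_sum_filter_not Finset.univ (fun a ↦ a ∉ bad)]
    congr 1
    apply Finset.sum_congr _ (fun _ _ ↦ rfl)
    ext a; simp
  have hsumr : ∑ a, r a = ∑ a ∈ Finset.univ.filter (fun a ↦ a ∉ bad), r a + ∑ a ∈ bad, r a := by
    rw [← Finset.sum_filter_add_sum_filter_not Finset.univ (fun a ↦ a ∉ bad)]
    congr 1
    apply Finset.sum_congr _ (fun _ _ ↦ rfl)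
    ext a; simp
  have hgoodsum : ∑ a ∈ Finset.univ.filter (fun a ↦ a ∉ bad), r a =
      ∑ a ∈ Finset.univ.filter (fun a ↦ a ∉ bad), t a :=
    Finset.sum_congr rfl fun a ha ↦ hgood a (Finset.mem_filter.1 ha).2
  have hbadt : ∑ a ∈ bad, t a ≤ bad.card * d := by
    have := Finset.sum_le_card_nsmul bad t d fun a _ ↦ htle a
    simpa using this
  have hbadr : ∑ a ∈ bad, r a ≤ bad.card * d := by
    have := Finset.sum_le_card_nsmul bad r d fun a _ ↦ hrle a
    simpa using this
  have h1 : bad.card * d = d * bad.card := mul_comm _ _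
  constructor
  · rw [hNsum, hsumt, hN₁sum, hsumr, hgoodsum]
    omega
  · rw [hNsum, hsumt, hN₁sum, hsumr, hgoodsum]
    omega

end Model

/-! ### Weil's bound for the number of points of `zᵖ - z = P(x)/Q(x)` -/

section Count

variable [Fintype K] {p : ℕ} [Fact p.Prime] [CharP K p]

/-- **Weil's bound for the Artin–Schreier curve `Yᵖ - Qᵖ⁻¹ Y - P Qᵖ⁻¹ = 0` over `𝔽_q`.** Let `K`
be a finite field of characteristic `p`, `P, Q ∈ K[X]` coprime with `deg P, deg Q ≤ k` and
`1 ≤ deg Q < p`, and suppose `P(c₀) = 0 ≠ Q(c₀)` for some `c₀ ∈ K`. Then the number `N` of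
`(a, b) ∈ K²` with `bᵖ - Q(a)ᵖ⁻¹ b - P(a) Q(a)ᵖ⁻¹ = 0` satisfies
`|N - (#K + 1)| ≤ (p-1)(kp-2) √#K + p(k+1)`.
Proof: the function field `F = K(X)[Y]/(Φ)` (irreducible: `irreducible_map_asPlaneModel`;
separable) has full constant field `K` (a rational place over `x = c₀`, from the root `b = 0` of
the separable fibre `Φ(c₀, Y)` by Kummer's theorem) and genus `g` with `2g ≤ (p-1)(kp-2)`
(`two_mul_genus_le_of_planeModel_weighted`, `y ∈ ℒ(k (x)_∞)`); Hasse–Weil gives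
`|N₁ - (q+1)| ≤ 2g√q` for its rational places, and `N ≤ N₁ + pk`, `N₁ ≤ N + p(k+1)` fibrewise
(the only inseparable fibres are the `≤ k` roots of `Q`). [cite: Weil1948]
[cite: Stichtenoth2009, Thm. 3.3.7, Prop. 3.7.8 and Thm. 5.2.3] [cite: Schmidt1976, Ch. II–III] -/
theorem abs_card_zeros_asPlaneModel_sub_le {P Q : K[X]} {k : ℕ} (hP : P.natDegree ≤ k)
    (hQ : Q.natDegree ≤ k) (hPQ : IsCoprime P Q) (hQ1 : 1 ≤ Q.natDegree) (hQp : Q.natDegree < p)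
    {c₀ : K} (hPc : P.eval c₀ = 0) (hQc : Q.eval c₀ ≠ 0) :
    |((Finset.univ.filter fun q : K × K ↦ (asPlaneModel p P Q).evalEval q.1 q.2 = 0).card : ℝ) -
        ((Fintype.card K : ℝ) + 1)| ≤
      ((p - 1) * (k * p - 2) : ℕ) * √(Fintype.card K : ℝ) + (p * (k + 1) : ℕ) := by
  have hpp : p.Prime := Fact.out
  have hp2 : 2 ≤ p := hpp.two_le
  have hQ0 : Q ≠ 0 := by rintro rfl; simp at hQ1
  set Φ := asPlaneModel p P Q with hΦ
  have hm : Φ.Monic := monic_asPlaneModel hp2 P Q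
  have hnat : Φ.natDegree = p := natDegree_asPlaneModel hp2 P Q
  -- the function field `F = K(X)[Y]/(Φ)`
  set ΦL : (RatFunc K)[X] := Φ.map (algebraMap K[X] (RatFunc K)) with hΦL
  have hmL : ΦL.Monic := hm.map _
  have hirrL : Irreducible ΦL := irreducible_map_asPlaneModel hPQ hQ1 hQp
  haveI : Fact (Irreducible ΦL) := ⟨hirrL⟩
  set pb := AdjoinRoot.powerBasis hirrL.ne_zero with hpb
  have hgen : pb.gen = AdjoinRoot.root ΦL := AdjoinRoot.powerBasis_gen _
  have hmin : minpoly (RatFunc K) pb.gen = ΦL := AdjoinRoot.minpoly_powerBasis_gen_of_monic hmL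
  have hdim : pb.dim = Φ.natDegree := by
    rw [← pb.natDegree_minpoly, hmin, hm.natDegree_map]
  haveI : IsAlgFunctionField K (AdjoinRoot ΦL) := isAlgFunctionField_of_powerBasis pb
  haveI : FiniteDimensional (RatFunc K) (AdjoinRoot ΦL) := pb.finite
  haveI : Algebra.IsSeparable (RatFunc K) (AdjoinRoot ΦL) :=
    isSeparable_adjoinRoot_of_separable hmL (separable_map_asPlaneModel P Q hQ0)
  have hfin : Module.finrank (RatFunc K) (AdjoinRoot ΦL) = Φ.natDegree := by
    rw [pb.finrank, hdim]
  -- the bad fibres: roots of `Q`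
  set bad : Finset K := Finset.univ.filter fun a : K ↦ Q.eval a = 0 with hbad
  have hbadk : bad.card ≤ k := by
    calc bad.card ≤ Q.roots.toFinset.card := by
          refine Finset.card_le_card fun a ha ↦ ?_
          rw [hbad, Finset.mem_filter] at ha
          rw [Multiset.mem_toFinset, mem_roots hQ0, IsRoot.def]
          exact ha.2
      _ ≤ Q.natDegree := (Multiset.toFinset_card_le _).trans (card_roots' Q)
      _ ≤ k := hQ
  have hsepf : ∀ a, a ∉ bad → (Φ.map (evalRingHom a)).Separable := fun a ha ↦ by
    refine separable_fibre_asPlaneModel P Q fun h ↦ ha ?_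
    rw [hbad, Finset.mem_filter]
    exact ⟨Finset.mem_univ a, h⟩
  obtain ⟨hup, hlow⟩ := card_zeros_le_card_ratPlaces_add_of_bad (K := K) (F := AdjoinRoot ΦL)
    hm hmin hfin bad hsepf
  -- a rational place over `x = c₀` (from the root `b = 0` of the separable fibre at `c₀`)
  have hrat : ∃ P₁ : PlaceOver K (AdjoinRoot ΦL), P₁.degree = 1 := by
    have h := card_filter_valuation_sub_lt_one_eq (K := K) (F := AdjoinRoot ΦL) hm hmin hfin c₀
      (separable_fibre_asPlaneModel P Q hQc)
    have hpos : 0 < (Finset.univ.filter fun b : K ↦ Φ.evalEval c₀ b = 0).card := by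
      refine Finset.card_pos.2 ⟨0, ?_⟩
      rw [Finset.mem_filter, hΦ, evalEval_asPlaneModel, hPc]
      refine ⟨Finset.mem_univ _, ?_⟩
      rw [zero_pow hpp.ne_zero, mul_zero, zero_mul, sub_zero, sub_zero]
    rw [← h] at hpos
    obtain ⟨P₁, hP₁⟩ := Finset.card_pos.1 hpos
    refine ⟨P₁, ?_⟩
    have := (Finset.mem_filter.1 hP₁).1
    rwa [Set.Finite.mem_toFinset] at this
  obtain ⟨P₁, hP₁⟩ := hrat
  haveI : IsIntegrallyClosedIn K (AdjoinRoot ΦL) := isIntegrallyClosedIn_of_isRational hP₁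
  -- `x`, `y ∈ ℒ(k (x)_∞)`, genus bound
  set x : AdjoinRoot ΦL := algebraMap K[X] (AdjoinRoot ΦL) X with hx
  have hxt : Transcendental K x := transcendental_algebraMap_X K (AdjoinRoot ΦL)
  have hy : pb.gen ∈ riemannRochSpace (k • (principalDivisor K x)⁻) := by
    have hΦy : aeval pb.gen ΦL = 0 := by
      rw [hgen, AdjoinRoot.aeval_eq, AdjoinRoot.mk_self]
    exact mem_riemannRochSpace_nsmul_negPart_of_aeval_eq_zero hΦy hm k
      (natDegree_coeff_asPlaneModel_le hp2 P Q hP hQ)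
  have hfinx : Module.finrank K⟮x⟯ (AdjoinRoot ΦL) = Φ.natDegree := by
    rw [finrank_adjoin_algebraMap_X_eq_dim pb, hdim]
  have hgenus : 2 * genus K (AdjoinRoot ΦL) ≤ (Φ.natDegree - 1) * (k * Φ.natDegree - 2) :=
    two_mul_genus_le_of_planeModel_weighted hxt hfinx k hy (hdim ▸ linearIndependent_monomial pb)
  rw [hnat] at hgenus hup hlow
  -- Hasse–Weil and the arithmetic
  set q := Fintype.card K with hq
  have hHW := card_toFinset_degree_eq_one_mem_Icc (K := K) (F := AdjoinRoot ΦL)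
  rw [Set.mem_Icc, ← hq] at hHW
  have hg : (2 * genus K (AdjoinRoot ΦL) : ℝ) ≤ ((p - 1) * (k * p - 2) : ℕ) := by
    exact_mod_cast hgenus
  have hs : 0 ≤ √(q : ℝ) := Real.sqrt_nonneg _
  have hgs := mul_le_mul_of_nonneg_right hg hs
  have hpk : p * bad.card ≤ p * k := Nat.mul_le_mul_left p hbadk
  have hup' : ((Finset.univ.filter fun q : K × K ↦ Φ.evalEval q.1 q.2 = 0).card : ℝ) ≤
      (finite_setOf_degree_eq (K := K) (F := AdjoinRoot ΦL) 1).toFinset.card + (p * k : ℕ) := by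
    exact_mod_cast hup.trans (by omega)
  have hlow' : ((finite_setOf_degree_eq (K := K) (F := AdjoinRoot ΦL) 1).toFinset.card : ℝ) ≤
      (Finset.univ.filter fun q : K × K ↦ Φ.evalEval q.1 q.2 = 0).card + (p * (k + 1) : ℕ) := by
    exact_mod_cast hlow.trans (by nlinarith)
  have hcast : ((p * (k + 1) : ℕ) : ℝ) = (p * k : ℕ) + p := by push_cast; ring
  have hp0 : (0 : ℝ) ≤ p := Nat.cast_nonneg _
  rw [abs_le]
  constructor
  · nlinarith [hHW.1, hHW.2]
  · nlinarith [hHW.1, hHW.2]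

end Count

end Literature.NumberTheory.DiophantineGeometry.AlgFunctionField
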